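import Literature.Topology.FourManifolds.RegularLevelFlowMap
import Literature.Topology.FourManifolds.MorseSublevelConnected
import Literature.AlgebraicTopology.FundamentalGroup.CircleValuedLift
import HarnessLib

/-!
# A Morse function with one minimum and one maximum on a simply connected closed manifold has
# connected regular levels

Topic `Literature/Topology/FourManifolds` (the "winding number" half of the dimension-`2` leaf
of `Literature.Topology.FourManifolds.HomotopySphere.contractibleSpace_compl_image_ball`; file
`HomotopyTwoSphereNoSaddle.lean`).  Everything here is **proved**, in any dimension, in the
setting of `GradientFlowLimits.lean` / `RegularLevelFlowMap.lean` (closed manifold `M`, Morse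
`f`, smooth gradient-like `ξ`, global flow):

**Theorem** (`IsGradientLike.not_simplyConnectedSpace_of_level_split`).  Suppose `f` has exactly
one critical point of index `0` and one of index `m = dim M`, and some level `f⁻¹(c)` lying in a
band `f⁻¹[c - ε, c + ε]` without critical values splits into two nonempty closed pieces
`K ⊔ K'`.  Then `M` is not simply connected.

This is the elementary content of the Mayer–Vietoris estimate `H₁(M) ↠ H̃₀(f⁻¹(c))` for the
decomposition `M = {f ≤ c} ∪ {f ≥ c}` into two connected pieces (one minimum, one maximum;
Matsumoto, *An Introduction to Morse Theory* (2001), proof of Thm. 3.35: "`M_{c+ε}` is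
connected"), carried out with a circle-valued map instead of homology (tom Dieck, *Algebraic
Topology* (2008), §2.7; the Pontryagin–Thom collapse of the two-sided hypersurface `K`):

1. (`RegularLevelFlowMap.lean`) the band `V = f⁻¹(c - ε, c + ε)` projects along trajectories
   onto the level (`levelProj`); `N = {z ∈ V | π z ∈ K}` and `V ∖ N` are open.
2. `g : M → ℝ/ℤ`, `g = ρ(f)` on `N` and `0` off `N`, with `ρ` a ramp from `0` below `c - ε` to
   `1` above `c + ε`, is continuous; it has the continuous real lifts `G_lo` (`= ρ(f)` on `N`,
   `0` elsewhere) on `{f < c + ε}` and `G_hi` (`1` elsewhere) on `{f > c - ε}`.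
3. (`MorseSublevelConnected.lean`) through the unique minimum `p⁻` and maximum `p⁺` there are
   paths `p⁻ ⇝ y ⇝ p⁺` staying below, then above, the level of `y`, for `y ∈ K` and for
   `y' ∈ K'`; along the first the real lift of `g` climbs by `1`, along the second by `0`.
4. (`CircleValuedLift.lean`, Hatcher Prop. 1.30) in a simply connected space the increment of a
   real lift depends only on the end points: contradiction.

## References

* Y. Matsumoto, *An Introduction to Morse Theory*, AMS (2001), proof of Thm. 3.35
  (pp. 119–120), §2.3 (c). [Matsumoto2001]
* T. tom Dieck, *Algebraic Topology*, EMS (2008), §2.7. [tomDieck2008]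
* A. Hatcher, *Algebraic Topology*, CUP (2002), Prop. 1.30; §2.2, Mayer–Vietoris sequences.
  [HatcherAT2002]
-/

open scoped Manifold ContDiff Topology unitInterval
open Set Function Filter

noncomputable section

namespace Literature.Topology.FourManifolds

open Flow

/-- Local notation: `𝔼 n` is the model Euclidean space `EuclideanSpace ℝ (Fin n)`. -/
local notation "𝔼 " n:arg => EuclideanSpace ℝ (Fin n)

/-! ### The ramp -/

/-- The ramp `ρ`: `0` on `(-∞, c - ε]`, `1` on `[c + ε, ∞)`, affine in between. [folklore] -/
def ramp (c ε t : ℝ) : ℝ := max 0 (min 1 ((t - (c - ε)) / (2 * ε)))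

/-- The ramp is continuous. [folklore] -/
theorem continuous_ramp (c ε : ℝ) : Continuous (ramp c ε) := by
  unfold ramp; fun_prop

/-- `0 ≤ ρ`. [folklore] -/
theorem ramp_nonneg (c ε t : ℝ) : 0 ≤ ramp c ε t := le_max_left _ _

/-- `ρ ≤ 1`. [folklore] -/
theorem ramp_le_one (c ε t : ℝ) : ramp c ε t ≤ 1 :=
  max_le zero_le_one (min_le_left _ _)

/-- `ρ = 0` below `c - ε`. [folklore] -/
theorem ramp_eq_zero {c ε t : ℝ} (hε : 0 < ε) (ht : t ≤ c - ε) : ramp c ε t = 0 := by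
  unfold ramp
  have : (t - (c - ε)) / (2 * ε) ≤ 0 := div_nonpos_of_nonpos_of_nonneg (by linarith) (by linarith)
  rw [max_eq_left]
  exact (min_le_right _ _).trans this

/-- `ρ = 1` above `c + ε`. [folklore] -/
theorem ramp_eq_one {c ε t : ℝ} (hε : 0 < ε) (ht : c + ε ≤ t) : ramp c ε t = 1 := by
  unfold ramp
  have : 1 ≤ (t - (c - ε)) / (2 * ε) := by
    rw [le_div_iff₀ (by linarith)]; linarith
  rw [min_eq_left this, max_eq_right zero_le_one]

/-! ### The circle-valued map of a split level -/

section Split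

variable {m : ℕ} {H : Type*} [TopologicalSpace H] {J : ModelWithCorners ℝ (𝔼 m) H}
  {M : Type*} [TopologicalSpace M] [ChartedSpace H M] [IsManifold J ∞ M]
  [T2Space M] [CompactSpace M] [BoundarylessManifold J M]
  {f : M → ℝ} {ξ : Π x : M, TangentSpace J x}

/-- **A disconnected regular level of a Morse function with one minimum and one maximum forces
`π₁ ≠ 1`.**  Let `f` be Morse on the closed manifold `M` with smooth gradient-like `ξ`, with
exactly one critical point of index `0` and one of index `m = dim M`; let the band
`f⁻¹[c - ε, c + ε]` contain no critical value and the level `f⁻¹(c)` be the disjoint union of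
two nonempty closed sets `K`, `K'`.  Then `M` is not simply connected. [cite: Matsumoto2001, proof of Thm. 3.35 (pp. 119–120)] [cite: tomDieck2008, §2.7] -/
theorem IsGradientLike.not_simplyConnectedSpace_of_level_split (hgl : IsGradientLike J f ξ)
    (hfM : IsMorse J f) (hξ : ContMDiff J J.tangent ∞ fun x => (⟨x, ξ x⟩ : TangentBundle J M))
    {pbot ptop : M} (hbot : criticalSetOfIndex J f 0 = {pbot})
    (htop : criticalSetOfIndex J f m = {ptop}) {c ε : ℝ} (hε : 0 < ε)
    (hval : ∀ q, IsMCriticalPt J f q → f q ∉ Icc (c - ε) (c + ε))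
    {K K' : Set M} (hK : IsClosed K) (hK' : IsClosed K') (hKK' : Disjoint K K')
    (hunion : K ∪ K' = {y | f y = c}) (hKne : K.Nonempty) (hK'ne : K'.Nonempty) :
    ¬ SimplyConnectedSpace M := by
  classical
  -- the band and the projection onto the level
  set V : Set M := {z | c - ε < f z ∧ f z < c + ε} with hV
  have hVopen : IsOpen V :=
    (isOpen_lt continuous_const hfM.contMDiff.continuous).inter
      (isOpen_lt hfM.contMDiff.continuous continuous_const)
  have hreg : ∀ x, f x = c → ¬ IsMCriticalPt J f x := fun x hx hcrit =>
    hval x hcrit ⟨by rw [hx]; linarith, by rw [hx]; linarith⟩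
  set π : M → M := levelProj hξ f c with hπ
  have hhits : ∀ z ∈ V, Hits (flowθ hξ) f c z := fun z hz =>
    hgl.hits_of_mem_Icc_of_forall_not_mem_Icc hfM hξ hval ⟨hz.1.le, hz.2.le⟩
  have hπcont : ContinuousOn π V := (hgl.continuousOn_levelProj hfM hξ hreg).mono hhits
  have hπlevel : ∀ z ∈ V, f (π z) = c := fun z hz => apply_levelProj hξ (hhits z hz)
  have hπid : ∀ y, f y = c → π y = y := fun y hy => hgl.levelProj_of_apply_eq hfM hξ hreg hy
  have hKsub : K ⊆ {y | f y = c} := hunion ▸ subset_union_left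
  have hK'sub : K' ⊆ {y | f y = c} := hunion ▸ subset_union_right
  -- `π z ∈ K ↔ π z ∉ K'` on `V`
  have hπK : ∀ z ∈ V, π z ∈ K ↔ π z ∉ K' := fun z hz => by
    have hmem : π z ∈ K ∪ K' := by rw [hunion]; exact hπlevel z hz
    constructor
    · exact fun h h' => hKK'.le_bot ⟨h, h'⟩
    · intro h; exact hmem.resolve_right h
  -- the open set `N`
  set N : Set M := {z | z ∈ V ∧ π z ∈ K} with hN
  have hNopen : IsOpen N := by
    have : N = V ∩ π ⁻¹' K'ᶜ := Set.ext fun z =>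
      ⟨fun h => ⟨h.1, (hπK z h.1).1 h.2⟩, fun h => ⟨h.1, (hπK z h.1).2 h.2⟩⟩
    rw [this]
    exact hπcont.isOpen_inter_preimage hVopen hK'.isOpen_compl
  have hVNopen : IsOpen (V ∩ Nᶜ) := by
    have : V ∩ Nᶜ = V ∩ π ⁻¹' Kᶜ := Set.ext fun z =>
      ⟨fun h => ⟨h.1, fun hk => h.2 ⟨h.1, hk⟩⟩, fun h => ⟨h.1, fun hn => h.2 hn.2⟩⟩
    rw [this]
    exact hπcont.isOpen_inter_preimage hVopen hK.isOpen_compl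
  -- the two real lifts
  set ρ : ℝ → ℝ := ramp c ε with hρ
  set Glo : M → ℝ := fun z => if z ∈ N then ρ (f z) else 0 with hGlo
  set Ghi : M → ℝ := fun z => if z ∈ N then ρ (f z) else 1 with hGhi
  have hρf : Continuous fun z => ρ (f z) := (continuous_ramp c ε).comp hfM.contMDiff.continuous
  -- continuity of `Glo` on `{f < c + ε}`
  have hGlo_cont : ∀ z₀, f z₀ < c + ε → ContinuousAt Glo z₀ := by
    intro z₀ hz₀
    by_cases hV₀ : z₀ ∈ V
    · by_cases hN₀ : z₀ ∈ N
      · have hev : Glo =ᶠ[𝓝 z₀] fun z => ρ (f z) := by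
          filter_upwards [hNopen.mem_nhds hN₀] with z hz
          simp only [hGlo, if_pos hz]
        exact (hρf.continuousAt).congr hev.symm
      · have hev : Glo =ᶠ[𝓝 z₀] fun _ => 0 := by
          filter_upwards [hVNopen.mem_nhds ⟨hV₀, hN₀⟩] with z hz
          simp only [hGlo, if_neg (show z ∉ N from hz.2)]
        exact continuousAt_const.congr hev.symm
    · -- `f z₀ ≤ c - ε`: squeeze between `0` and `ρ ∘ f → 0`
      have hle : f z₀ ≤ c - ε := by
        by_contra h; push Not at h; exact hV₀ ⟨h, hz₀⟩
      have hN₀ : z₀ ∉ N := fun h => hV₀ h.1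
      have hval0 : Glo z₀ = 0 := by simp only [hGlo, if_neg hN₀]
      have hρ0 : ρ (f z₀) = 0 := ramp_eq_zero hε hle
      rw [ContinuousAt, hval0]
      have h2 : Tendsto (fun z => ρ (f z)) (𝓝 z₀) (𝓝 0) := by
        have := hρf.continuousAt (x := z₀); rwa [ContinuousAt, hρ0] at this
      refine tendsto_of_tendsto_of_tendsto_of_le_of_le tendsto_const_nhds h2 (fun z => ?_) (fun z => ?_)
      · simp only [hGlo]; split_ifs
        · exact ramp_nonneg _ _ _
        · exact le_rfl
      · simp only [hGlo]; split_ifs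
        · exact le_rfl
        · exact ramp_nonneg _ _ _
  -- continuity of `Ghi` on `{c - ε < f}`
  have hGhi_cont : ∀ z₀, c - ε < f z₀ → ContinuousAt Ghi z₀ := by
    intro z₀ hz₀
    by_cases hV₀ : z₀ ∈ V
    · by_cases hN₀ : z₀ ∈ N
      · have hev : Ghi =ᶠ[𝓝 z₀] fun z => ρ (f z) := by
          filter_upwards [hNopen.mem_nhds hN₀] with z hz
          simp only [hGhi, if_pos hz]
        exact (hρf.continuousAt).congr hev.symm
      · have hev : Ghi =ᶠ[𝓝 z₀] fun _ => 1 := by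
          filter_upwards [hVNopen.mem_nhds ⟨hV₀, hN₀⟩] with z hz
          simp only [hGhi, if_neg (show z ∉ N from hz.2)]
        exact continuousAt_const.congr hev.symm
    · have hge : c + ε ≤ f z₀ := by
        by_contra h; push Not at h; exact hV₀ ⟨hz₀, h⟩
      have hN₀ : z₀ ∉ N := fun h => hV₀ h.1
      have hval1 : Ghi z₀ = 1 := by simp only [hGhi, if_neg hN₀]
      have hρ1 : ρ (f z₀) = 1 := ramp_eq_one hε hge
      rw [ContinuousAt, hval1]
      have h2 : Tendsto (fun z => ρ (f z)) (𝓝 z₀) (𝓝 1) := by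
        have := hρf.continuousAt (x := z₀); rwa [ContinuousAt, hρ1] at this
      refine tendsto_of_tendsto_of_tendsto_of_le_of_le h2 tendsto_const_nhds (fun z => ?_) (fun z => ?_)
      · simp only [hGhi]; split_ifs
        · exact le_rfl
        · exact ramp_le_one _ _ _
      · simp only [hGhi]; split_ifs
        · exact ramp_le_one _ _ _
        · exact le_rfl
  -- the circle-valued map
  set gfun : M → AddCircle (1 : ℝ) := fun z => if z ∈ N then ((ρ (f z) : ℝ) : AddCircle (1 : ℝ)) else 0
    with hgfun
  have hg_lo : ∀ z, ((Glo z : ℝ) : AddCircle (1 : ℝ)) = gfun z := fun z => by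
    simp only [hGlo, hgfun]; split_ifs <;> simp
  have hg_hi : ∀ z, ((Ghi z : ℝ) : AddCircle (1 : ℝ)) = gfun z := fun z => by
    simp only [hGhi, hgfun]; split_ifs
    · rfl
    · exact AddCircle.coe_period (1 : ℝ)
  have hgcont : Continuous gfun := by
    refine continuous_iff_continuousAt.2 fun z₀ => ?_
    rcases lt_or_ge (f z₀) (c + ε) with h | h
    · have : gfun = fun z => ((Glo z : ℝ) : AddCircle (1 : ℝ)) := funext fun z => (hg_lo z).symm
      rw [this]
      exact (AddCircle.continuous_mk' (1 : ℝ)).continuousAt.comp (hGlo_cont z₀ h)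
    · have : gfun = fun z => ((Ghi z : ℝ) : AddCircle (1 : ℝ)) := funext fun z => (hg_hi z).symm
      rw [this]
      exact (AddCircle.continuous_mk' (1 : ℝ)).continuousAt.comp (hGhi_cont z₀ (by linarith))
  set g : C(M, AddCircle (1 : ℝ)) := ⟨gfun, hgcont⟩ with hg
  -- the points
  obtain ⟨y, hy⟩ := hKne
  obtain ⟨y', hy'⟩ := hK'ne
  have hfy : f y = c := hKsub hy
  have hfy' : f y' = c := hK'sub hy'
  have hyN : y ∈ N := ⟨⟨by rw [hfy]; linarith, by rw [hfy]; linarith⟩, by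
    show π y ∈ K; rw [hπid y hfy]; exact hy⟩
  have hy'N : y' ∉ N := fun h => by
    have : π y' ∈ K := h.2
    rw [hπid y' hfy'] at this
    exact hKK'.le_bot ⟨this, hy'⟩
  -- paths through the bottom and the top
  obtain ⟨γ₁, hγ₁⟩ := hgl.exists_path_forall_ge hfM hξ hbot y
  obtain ⟨γ₂, hγ₂⟩ := hgl.exists_path_forall_le hfM hξ htop y
  obtain ⟨γ₁', hγ₁'⟩ := hgl.exists_path_forall_ge hfM hξ hbot y'
  obtain ⟨γ₂', hγ₂'⟩ := hgl.exists_path_forall_le hfM hξ htop y'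
  -- the bottom is below the band, the top above it
  have hbot_crit : IsMCriticalPt J f pbot := by
    have : pbot ∈ criticalSetOfIndex J f 0 := by rw [hbot]; exact mem_singleton _
    exact ((mem_criticalSetOfIndex).1 this).1
  have htop_crit : IsMCriticalPt J f ptop := by
    have : ptop ∈ criticalSetOfIndex J f m := by rw [htop]; exact mem_singleton _
    exact ((mem_criticalSetOfIndex).1 this).1
  have hfbot : f pbot < c - ε := by
    have h1 : f pbot ≤ c := by have := hγ₁ 0; simp only [Path.source] at this; rwa [hfy] at this
    by_contra h; push Not at h
    exact hval pbot hbot_crit ⟨h, by linarith⟩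
  have hftop : c + ε < f ptop := by
    have h1 : c ≤ f ptop := by have := hγ₂ 1; simp only [Path.target] at this; rwa [hfy] at this
    by_contra h; push Not at h
    exact hval ptop htop_crit ⟨by linarith, h⟩
  have hbotN : pbot ∉ N := fun h => by have := h.1.1; linarith
  have htopN : ptop ∉ N := fun h => by have := h.1.2; linarith
  -- real lifts along the concatenated paths
  have lift_of : ∀ (γa : Path pbot y) (γb : Path y ptop) (shift : ℝ),
      (∀ s, f (γa s) ≤ f y) → (∀ s, f y ≤ f (γb s)) → (Glo y = Ghi y + shift) →
      ∃ A : I → ℝ, Continuous A ∧ (∀ t, ((A t : ℝ) : AddCircle (1 : ℝ)) = g ((γa.trans γb) t)) ∧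
        A 0 = Glo pbot ∧ A 1 = Ghi ptop + shift := by
    intro γa γb shift ha hb hshift
    refine ⟨fun t => if (t : ℝ) ≤ 1 / 2 then Glo ((γa.trans γb) t) else Ghi ((γa.trans γb) t) + shift,
      ?_, fun t => ?_, ?_, ?_⟩
    · have htr : ∀ t : I, (γa.trans γb) t =
          if (t : ℝ) ≤ 1 / 2 then γa.extend (2 * t) else γb.extend (2 * t - 1) := fun t => rfl
      refine continuous_if_le continuous_subtype_val continuous_const ?_ ?_ ?_
      · -- on `t ≤ 1/2` the path is `γa`, below the level
        refine fun t ht => (hGlo_cont _ ?_).comp_continuousWithinAt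
          ((γa.trans γb).continuous.continuousWithinAt)
        rw [htr, if_pos (show (t : ℝ) ≤ 1 / 2 from ht)]
        exact lt_of_le_of_lt ((ha (projIcc 0 1 zero_le_one _)).trans hfy.le) (by linarith)
      · refine fun t ht => ((hGhi_cont _ ?_).comp_continuousWithinAt
          ((γa.trans γb).continuous.continuousWithinAt)).add continuousWithinAt_const
        have ht' : (1 : ℝ) / 2 ≤ t := ht
        rcases ht'.eq_or_lt with heq | hlt
        · rw [htr, if_pos heq.ge, show 2 * (t : ℝ) = 1 by rw [← heq]; norm_num, Path.extend_one, hfy]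
          linarith
        · rw [htr, if_neg (not_le.2 hlt)]
          exact lt_of_lt_of_le (by linarith) (hfy.ge.trans (hb (projIcc 0 1 zero_le_one _)))
      · intro t ht
        have ht' : (t : ℝ) = 1 / 2 := ht
        rw [htr, if_pos ht'.le, show 2 * (t : ℝ) = 1 by rw [ht']; norm_num, Path.extend_one]
        exact hshift
    · show ((ite _ _ _ : ℝ) : AddCircle (1 : ℝ)) = gfun ((γa.trans γb) t)
      split_ifs
      · exact hg_lo _
      · have hs : ((shift : ℝ) : AddCircle (1 : ℝ)) = 0 := by
          have h1 := hg_lo y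
          rw [hshift, ← hg_hi y, AddCircle.coe_add] at h1
          simpa using h1
        rw [AddCircle.coe_add, hs, add_zero]
        exact hg_hi _
    · simp
    · show (if ((1 : I) : ℝ) ≤ 1 / 2 then _ else _) = _
      rw [if_neg (by norm_num)]
      simp
  -- values at the special points
  have hGlo_bot : Glo pbot = 0 := by simp only [hGlo, if_neg hbotN]
  have hGhi_top : Ghi ptop = 1 := by simp only [hGhi, if_neg htopN]
  have hGlo_y : Glo y = Ghi y + 0 := by simp only [hGlo, hGhi, if_pos hyN, add_zero]
  have hGlo_y' : Glo y' = Ghi y' + (-1) := by simp only [hGlo, hGhi, if_neg hy'N]; norm_num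
  obtain ⟨A, hAc, hAg, hA0, hA1⟩ := lift_of γ₁ γ₂ 0 hγ₁ hγ₂ hGlo_y
  -- for `y'` re-base the paths (same statement with `y'`)
  have lift_of' : ∃ B : I → ℝ, Continuous B ∧
      (∀ t, ((B t : ℝ) : AddCircle (1 : ℝ)) = g ((γ₁'.trans γ₂') t)) ∧
        B 0 = Glo pbot ∧ B 1 = Ghi ptop + (-1) := by
    refine ⟨fun t => if (t : ℝ) ≤ 1 / 2 then Glo ((γ₁'.trans γ₂') t) else Ghi ((γ₁'.trans γ₂') t) + (-1),
      ?_, fun t => ?_, ?_, ?_⟩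
    · have htr : ∀ t : I, (γ₁'.trans γ₂') t =
          if (t : ℝ) ≤ 1 / 2 then γ₁'.extend (2 * t) else γ₂'.extend (2 * t - 1) := fun t => rfl
      refine continuous_if_le continuous_subtype_val continuous_const ?_ ?_ ?_
      · refine fun t ht => (hGlo_cont _ ?_).comp_continuousWithinAt
          ((γ₁'.trans γ₂').continuous.continuousWithinAt)
        rw [htr, if_pos (show (t : ℝ) ≤ 1 / 2 from ht)]
        exact lt_of_le_of_lt ((hγ₁' (projIcc 0 1 zero_le_one _)).trans hfy'.le) (by linarith)
      · refine fun t ht => ((hGhi_cont _ ?_).comp_continuousWithinAt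
          ((γ₁'.trans γ₂').continuous.continuousWithinAt)).add continuousWithinAt_const
        have ht' : (1 : ℝ) / 2 ≤ t := ht
        rcases ht'.eq_or_lt with heq | hlt
        · rw [htr, if_pos heq.ge, show 2 * (t : ℝ) = 1 by rw [← heq]; norm_num, Path.extend_one, hfy']
          linarith
        · rw [htr, if_neg (not_le.2 hlt)]
          exact lt_of_lt_of_le (by linarith) (hfy'.ge.trans (hγ₂' (projIcc 0 1 zero_le_one _)))
      · intro t ht
        have ht' : (t : ℝ) = 1 / 2 := ht
        rw [htr, if_pos ht'.le, show 2 * (t : ℝ) = 1 by rw [ht']; norm_num, Path.extend_one]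
        exact hGlo_y'
    · show ((ite _ _ _ : ℝ) : AddCircle (1 : ℝ)) = gfun ((γ₁'.trans γ₂') t)
      split_ifs
      · exact hg_lo _
      · rw [AddCircle.coe_add]
        have : (((-1 : ℝ)) : AddCircle (1 : ℝ)) = 0 := by
          rw [AddCircle.coe_neg, neg_eq_zero]; exact AddCircle.coe_period (1 : ℝ)
        rw [this, add_zero]
        exact hg_hi _
    · simp
    · show (if ((1 : I) : ℝ) ≤ 1 / 2 then _ else _) = _
      rw [if_neg (by norm_num)]
      simp
  obtain ⟨B, hBc, hBg, hB0, hB1⟩ := lift_of'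
  refine Literature.AlgebraicTopology.FundamentalGroup.AddCircle.not_simplyConnectedSpace_of_lift_sub_ne
    g (γ₁.trans γ₂) (γ₁'.trans γ₂') hAc hBc hAg hBg ?_
  rw [hA0, hA1, hB0, hB1, hGlo_bot, hGhi_top]
  norm_num

end Split

end Literature.Topology.FourManifolds
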